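import Summits.KontsevichZagierPeriods.Zeta5Search.Certificates.VIMLevel2NKKey2
import HarnessLib

/-!
# ζ(5) search — brown9 LEVEL 2 (R-NK), key: level-1 reduction to the basis `(T(n;p,q), T(n;p+1,q))` and the assembly (cell `pub-zeta5`, certifier `cert-1`)

HONEST FRAMING: systematic search; no irrationality claim unless certified.

The termwise identity behind the ttrl2 lane's R-NK certificate (`r1c/R_NK.json`; see `Certificates/VIMLevel2NKData.lean`)
involves the 13 inner-block values `U = T(n+1;p+3,q+2)` and `T(n;p+i,q+j)` (`p = 3n−x−k`, `q = 2n−k`, `x = k₃`, `k = k₅`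
rational parameters). Here every one of them is expressed in the basis `T(n;p,q), T(n;p+1,q)` of the certified rank-2 module
(`coord_*`: `d·Y = c₀·T(n;p,q) + c₁·T(n;p+1,q)` with small REDUCED polynomial coordinates, re-derived in the seat —
`HOME/cert-1/g2/py/nk_coords2.py`) from eleven level-1 relation instances (P2 ×4, M3 ×3, M4 ×3, N1; `Certificates/VIMInnerModule(N)`),
each step being a small linear combination over OPAQUE polynomial values `peval e [n,x,k]` whose polynomial bookkeeping is
checked by the kernel (`PolyReflect.peval_eq_of_kron`, one integer evaluation each). `NK_key` then assembles: multiplying the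
cleared termwise combination `KEYPOLY` by `L` and substituting coordinates leaves `gcd₀·FIN0·T(n;p,q) + gcd₁·FIN1·T(n;p+1,q)`,
so the two kernel-checked coordinate identities `fin0/fin1` give `KEYPOLY = 0` on the region `x < 0`, `0 ≤ k ≤ n−1`, `n ≥ 2`
(where all cancelled leading coefficients are nonzero). No named facts.

Part 3: coordinates of the chain atoms (continued). (File 3 of 4.)
-/

noncomputable section

namespace Summit.KontsevichZagierPeriods.Zeta5Search.Certificates

namespace VIMInner.NK

open PolyReflect
open Lean.Grind.CommRing (Expr)

/-- **Coordinates of `T n ((3 * (n : ℚ) - x - k) + 3) ((2 * (n : ℚ) - k) + 1)`** (from M3(3,0)): `d·Y = c₀·T(n;p,q) + c₁·T(n;p+1,q)`. -/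
theorem coord_T31 (n : ℕ) (hn : 2 ≤ n) (x k : ℚ) (hx : x < 0) (hk0 : 0 ≤ k) (hk : k + 1 ≤ (n : ℚ)) :
    peval eD_T31 [(n : ℚ), x, k] * T n ((3 * (n : ℚ) - x - k) + 3) ((2 * (n : ℚ) - k) + 1)
      = peval eC0_T31 [(n : ℚ), x, k] * T n (3 * (n : ℚ) - x - k) (2 * (n : ℚ) - k) + peval eC1_T31 [(n : ℚ), x, k] * T n ((3 * (n : ℚ) - x - k) + 1) (2 * (n : ℚ) - k) := by
  have hn' : (2 : ℚ) ≤ n := by exact_mod_cast hn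
  have d0 : pvar [(n : ℚ), x, k] 0 = (n : ℚ) := rfl
  have d1 : pvar [(n : ℚ), x, k] 1 = x := rfl
  have d2 : pvar [(n : ℚ), x, k] 2 = k := rfl
  have hrel := relM3a n hn x k
  have cT30 := coord_T30 n hn x k hx hk0 hk
  have cT40 := coord_T40 n hn x k hx hk0 hk
  have kd := peval_eq_of_kron (Expr.mul eG_T31 eD_T31) (Expr.mul eRM3a_T31 eLd_T31) (by decide +kernel)
    (by decide +kernel) (n : ℚ) x k
  have k0 := peval_eq_of_kron (Expr.mul eG_T31 eC0_T31)
    (Expr.add (Expr.neg (Expr.mul eRM3a_T30 (Expr.mul eLq_T31_T30 eC0_T30))) (Expr.neg (Expr.mul eRM3a_T40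
    (Expr.mul eLq_T31_T40 eC0_T40)))) (by decide +kernel) (by decide +kernel) (n : ℚ) x k
  have k1 := peval_eq_of_kron (Expr.mul eG_T31 eC1_T31)
    (Expr.add (Expr.neg (Expr.mul eRM3a_T30 (Expr.mul eLq_T31_T30 eC1_T30))) (Expr.neg (Expr.mul eRM3a_T40
    (Expr.mul eLq_T31_T40 eC1_T40)))) (by decide +kernel) (by decide +kernel) (n : ℚ) x k
  have klT30 := peval_eq_of_kron (Expr.mul eLq_T31_T30 eD_T30) eLd_T31 (by decide +kernel) (by decide +kernel) (n : ℚ) x k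
  have klT40 := peval_eq_of_kron (Expr.mul eLq_T31_T40 eD_T40) eLd_T31 (by decide +kernel) (by decide +kernel) (n : ℚ) x k
  simp only [peval_add, peval_neg, peval_mul] at kd k0 k1 klT30 klT40
  have hG : peval eG_T31 [(n : ℚ), x, k] ≠ 0 := by
    simp only [eG_T31, peval_add, peval_mul, peval_num, peval_var, d0, d1, d2]
    push_cast
    exact (mul_ne_zero (ne_of_lt (by linarith)) (mul_ne_zero (ne_of_lt (by linarith)) (mul_ne_zero (ne_of_lt (by linarith)) (ne_of_lt (by linarith)))))
  apply mul_left_cancel₀ hG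
  linear_combination T n ((3 * (n : ℚ) - x - k) + 3) ((2 * (n : ℚ) - k) + 1) * kd + peval eLd_T31 [(n : ℚ), x, k] * hrel - T n (3
    * (n : ℚ) - x - k) (2 * (n : ℚ) - k) * k0 - T n ((3 * (n : ℚ) - x - k) + 1) (2 * (n : ℚ) - k) * k1 +
    (-(peval eRM3a_T30 [(n : ℚ), x, k]) * peval eLq_T31_T30 [(n : ℚ), x, k]) * cT30 + ((peval eRM3a_T30 [(n
    : ℚ), x, k]) * T n ((3 * (n : ℚ) - x - k) + 3) (2 * (n : ℚ) - k)) * klT30 + (-(peval eRM3a_T40 [(n : ℚ),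
    x, k]) * peval eLq_T31_T40 [(n : ℚ), x, k]) * cT40 + ((peval eRM3a_T40 [(n : ℚ), x, k]) * T n ((3 * (n :
    ℚ) - x - k) + 4) (2 * (n : ℚ) - k)) * klT40

/-- Cancelled factor `g` of the coordinate step for `T n ((3 * (n : ℚ) - x - k) + 4) ((2 * (n : ℚ) - k) + 1)`: `(x - 3)*(-w + x - 3)`. -/
def eG_T41 : Expr :=
  (Expr.mul (Expr.add (Expr.var 1) (Expr.num (-3))) (Expr.add (Expr.add (Expr.neg (Expr.var 0)) (Expr.var 1)) (Expr.num (-3))))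

/-- Common denominator of the step for `T n ((3 * (n : ℚ) - x - k) + 4) ((2 * (n : ℚ) - k) + 1)`: `(x - 3)*(x - 2)*(x - 1)*(-k + w + 1)*(k - 2*w + x - 4)*(k - 2*w + x - 3)*(k - 2*w + x - 2)`. -/
def eLd_T41 : Expr :=
  (Expr.mul (Expr.add (Expr.var 1) (Expr.num (-1))) (Expr.mul (Expr.add (Expr.var 1) (Expr.num (-3))) (Expr.mul (Expr.add (Expr.var 1) (Expr.num (-2))) (Expr.mul (Expr.add (Expr.add
  (Expr.var 0) (Expr.neg (Expr.var 2))) (Expr.num 1)) (Expr.mul (Expr.add (Expr.add (Expr.add (Expr.mul (Expr.num (-2)) (Expr.var 0)) (Expr.var 1)) (Expr.var 2)) (Expr.num (-4)))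
  (Expr.mul (Expr.add (Expr.add (Expr.add (Expr.mul (Expr.num (-2)) (Expr.var 0)) (Expr.var 1)) (Expr.var 2)) (Expr.num (-3))) (Expr.add (Expr.add (Expr.add (Expr.mul (Expr.num
  (-2)) (Expr.var 0)) (Expr.var 1)) (Expr.var 2)) (Expr.num (-2)))))))))

/-- Cofactor `L/d` of `T n ((3 * (n : ℚ) - x - k) + 3) (2 * (n : ℚ) - k)` in the step for `T n ((3 * (n : ℚ) - x - k) + 4) ((2 * (n : ℚ) - k) + 1)`: `-k**2*x + 3*k**2 + 3*k*w*x - 9*k*w - k*x**2 + 8*k*x - 15*k - 2*w**2*x + 6*w**2 + w*x**2 - 9*w*x + 18*w + x**2 - 7*x + 12`. -/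
def eLq_T41_T30 : Expr :=
  (Expr.mul (Expr.add (Expr.var 1) (Expr.num (-3))) (Expr.mul (Expr.add (Expr.add (Expr.var 0) (Expr.neg (Expr.var 2))) (Expr.num 1)) (Expr.add (Expr.add (Expr.add (Expr.mul
  (Expr.num (-2)) (Expr.var 0)) (Expr.var 1)) (Expr.var 2)) (Expr.num (-4)))))

/-- Cofactor `L/d` of `T n ((3 * (n : ℚ) - x - k) + 4) (2 * (n : ℚ) - k)` in the step for `T n ((3 * (n : ℚ) - x - k) + 4) ((2 * (n : ℚ) - k) + 1)`: `-k + w + 1`. -/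
def eLq_T41_T40 : Expr :=
  (Expr.add (Expr.add (Expr.var 0) (Expr.neg (Expr.var 2))) (Expr.num 1))

/-- Cofactor `L/d` of `T n ((3 * (n : ℚ) - x - k) + 3) ((2 * (n : ℚ) - k) + 1)` in the step for `T n ((3 * (n : ℚ) - x - k) + 4) ((2 * (n : ℚ) - k) + 1)`: `k*x**2 - 5*k*x + 6*k - 2*w*x**2 + 10*w*x - 12*w + x**3 - 9*x**2 + 26*x - 24`. -/
def eLq_T41_T31 : Expr :=
  (Expr.mul (Expr.add (Expr.var 1) (Expr.num (-3))) (Expr.mul (Expr.add (Expr.var 1) (Expr.num (-2))) (Expr.add (Expr.add (Expr.add (Expr.mul (Expr.num (-2)) (Expr.var 0)) (Expr.var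
  1)) (Expr.var 2)) (Expr.num (-4)))))

/-- **Coordinates of `T n ((3 * (n : ℚ) - x - k) + 4) ((2 * (n : ℚ) - k) + 1)`** (from M4(3,0)): `d·Y = c₀·T(n;p,q) + c₁·T(n;p+1,q)`. -/
theorem coord_T41 (n : ℕ) (hn : 2 ≤ n) (x k : ℚ) (hx : x < 0) (hk0 : 0 ≤ k) (hk : k + 1 ≤ (n : ℚ)) :
    peval eD_T41 [(n : ℚ), x, k] * T n ((3 * (n : ℚ) - x - k) + 4) ((2 * (n : ℚ) - k) + 1)
      = peval eC0_T41 [(n : ℚ), x, k] * T n (3 * (n : ℚ) - x - k) (2 * (n : ℚ) - k) + peval eC1_T41 [(n : ℚ), x, k] * T n ((3 * (n : ℚ) - x - k) + 1) (2 * (n : ℚ) - k) := by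
  have hn' : (2 : ℚ) ≤ n := by exact_mod_cast hn
  have d0 : pvar [(n : ℚ), x, k] 0 = (n : ℚ) := rfl
  have d1 : pvar [(n : ℚ), x, k] 1 = x := rfl
  have hrel := relM4a n hn x k
  have cT30 := coord_T30 n hn x k hx hk0 hk
  have cT40 := coord_T40 n hn x k hx hk0 hk
  have cT31 := coord_T31 n hn x k hx hk0 hk
  have kd := peval_eq_of_kron (Expr.mul eG_T41 eD_T41) (Expr.mul eRM4a_T41 eLd_T41) (by decide +kernel)
    (by decide +kernel) (n : ℚ) x k
  have k0 := peval_eq_of_kron (Expr.mul eG_T41 eC0_T41)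
    (Expr.add (Expr.add (Expr.neg (Expr.mul eRM4a_T30 (Expr.mul eLq_T41_T30 eC0_T30))) (Expr.neg (Expr.mul
    eRM4a_T40 (Expr.mul eLq_T41_T40 eC0_T40)))) (Expr.neg (Expr.mul eRM4a_T31 (Expr.mul eLq_T41_T31
    eC0_T31)))) (by decide +kernel) (by decide +kernel) (n : ℚ) x k
  have k1 := peval_eq_of_kron (Expr.mul eG_T41 eC1_T41)
    (Expr.add (Expr.add (Expr.neg (Expr.mul eRM4a_T30 (Expr.mul eLq_T41_T30 eC1_T30))) (Expr.neg (Expr.mul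
    eRM4a_T40 (Expr.mul eLq_T41_T40 eC1_T40)))) (Expr.neg (Expr.mul eRM4a_T31 (Expr.mul eLq_T41_T31
    eC1_T31)))) (by decide +kernel) (by decide +kernel) (n : ℚ) x k
  have klT30 := peval_eq_of_kron (Expr.mul eLq_T41_T30 eD_T30) eLd_T41 (by decide +kernel) (by decide +kernel) (n : ℚ) x k
  have klT40 := peval_eq_of_kron (Expr.mul eLq_T41_T40 eD_T40) eLd_T41 (by decide +kernel) (by decide +kernel) (n : ℚ) x k
  have klT31 := peval_eq_of_kron (Expr.mul eLq_T41_T31 eD_T31) eLd_T41 (by decide +kernel) (by decide +kernel) (n : ℚ) x k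
  simp only [peval_add, peval_neg, peval_mul] at kd k0 k1 klT30 klT40 klT31
  have hG : peval eG_T41 [(n : ℚ), x, k] ≠ 0 := by
    simp only [eG_T41, peval_add, peval_neg, peval_mul, peval_num, peval_var, d0, d1]
    push_cast
    exact (mul_ne_zero (ne_of_lt (by linarith)) (ne_of_lt (by linarith)))
  apply mul_left_cancel₀ hG
  linear_combination T n ((3 * (n : ℚ) - x - k) + 4) ((2 * (n : ℚ) - k) + 1) * kd + peval eLd_T41 [(n : ℚ), x, k] * hrel - T n (3
    * (n : ℚ) - x - k) (2 * (n : ℚ) - k) * k0 - T n ((3 * (n : ℚ) - x - k) + 1) (2 * (n : ℚ) - k) * k1 +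
    (-(peval eRM4a_T30 [(n : ℚ), x, k]) * peval eLq_T41_T30 [(n : ℚ), x, k]) * cT30 + ((peval eRM4a_T30 [(n
    : ℚ), x, k]) * T n ((3 * (n : ℚ) - x - k) + 3) (2 * (n : ℚ) - k)) * klT30 + (-(peval eRM4a_T40 [(n : ℚ),
    x, k]) * peval eLq_T41_T40 [(n : ℚ), x, k]) * cT40 + ((peval eRM4a_T40 [(n : ℚ), x, k]) * T n ((3 * (n :
    ℚ) - x - k) + 4) (2 * (n : ℚ) - k)) * klT40 + (-(peval eRM4a_T31 [(n : ℚ), x, k]) * peval eLq_T41_T31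
    [(n : ℚ), x, k]) * cT31 + ((peval eRM4a_T31 [(n : ℚ), x, k]) * T n ((3 * (n : ℚ) - x - k) + 3) ((2 * (n
    : ℚ) - k) + 1)) * klT31

/-- Cancelled factor `g` of the coordinate step for `T n ((3 * (n : ℚ) - x - k) + 3) ((2 * (n : ℚ) - k) + 2)`: `(x - 2)*(x - 1)*(-2*w + x - 2)*(k - 2*w + x - 4)`. -/
def eG_T32 : Expr :=
  (Expr.mul (Expr.add (Expr.var 1) (Expr.num (-1))) (Expr.mul (Expr.add (Expr.var 1) (Expr.num (-2))) (Expr.mul (Expr.add (Expr.add (Expr.mul (Expr.num (-2)) (Expr.var 0)) (Expr.var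
  1)) (Expr.num (-2))) (Expr.add (Expr.add (Expr.add (Expr.mul (Expr.num (-2)) (Expr.var 0)) (Expr.var 1)) (Expr.var 2)) (Expr.num (-4))))))

/-- Common denominator of the step for `T n ((3 * (n : ℚ) - x - k) + 3) ((2 * (n : ℚ) - k) + 2)`: `(2 - x)*(x - 1)*(-k + w + 1)*(k - 2*w + x - 4)*(k - 2*w + x - 3)*(k - 2*w + x - 2)`. -/
def eLd_T32 : Expr :=
  (Expr.mul (Expr.num (-1)) (Expr.mul (Expr.add (Expr.var 1) (Expr.num (-1))) (Expr.mul (Expr.add (Expr.var 1) (Expr.num (-2))) (Expr.mul (Expr.add (Expr.add (Expr.var 0) (Expr.neg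
  (Expr.var 2))) (Expr.num 1)) (Expr.mul (Expr.add (Expr.add (Expr.add (Expr.mul (Expr.num (-2)) (Expr.var 0)) (Expr.var 1)) (Expr.var 2)) (Expr.num (-4))) (Expr.mul (Expr.add
  (Expr.add (Expr.add (Expr.mul (Expr.num (-2)) (Expr.var 0)) (Expr.var 1)) (Expr.var 2)) (Expr.num (-3))) (Expr.add (Expr.add (Expr.add (Expr.mul (Expr.num (-2)) (Expr.var 0))
  (Expr.var 1)) (Expr.var 2)) (Expr.num (-2)))))))))

/-- Cofactor `L/d` of `T n ((3 * (n : ℚ) - x - k) + 3) ((2 * (n : ℚ) - k) + 1)` in the step for `T n ((3 * (n : ℚ) - x - k) + 3) ((2 * (n : ℚ) - k) + 2)`: `-k*x + 2*k + 2*w*x - 4*w - x**2 + 6*x - 8`. -/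
def eLq_T32_T31 : Expr :=
  (Expr.mul (Expr.num (-1)) (Expr.mul (Expr.add (Expr.var 1) (Expr.num (-2))) (Expr.add (Expr.add (Expr.add (Expr.mul (Expr.num (-2)) (Expr.var 0)) (Expr.var 1)) (Expr.var 2))
  (Expr.num (-4)))))

/-- Cofactor `L/d` of `T n ((3 * (n : ℚ) - x - k) + 4) ((2 * (n : ℚ) - k) + 1)` in the step for `T n ((3 * (n : ℚ) - x - k) + 3) ((2 * (n : ℚ) - k) + 2)`: `1`. -/
def eLq_T32_T41 : Expr :=
  (Expr.num 1)

/-- **Coordinates of `T n ((3 * (n : ℚ) - x - k) + 3) ((2 * (n : ℚ) - k) + 2)`** (from M3(3,1)): `d·Y = c₀·T(n;p,q) + c₁·T(n;p+1,q)`. -/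
theorem coord_T32 (n : ℕ) (hn : 2 ≤ n) (x k : ℚ) (hx : x < 0) (hk0 : 0 ≤ k) (hk : k + 1 ≤ (n : ℚ)) :
    peval eD_T32 [(n : ℚ), x, k] * T n ((3 * (n : ℚ) - x - k) + 3) ((2 * (n : ℚ) - k) + 2)
      = peval eC0_T32 [(n : ℚ), x, k] * T n (3 * (n : ℚ) - x - k) (2 * (n : ℚ) - k) + peval eC1_T32 [(n : ℚ), x, k] * T n ((3 * (n : ℚ) - x - k) + 1) (2 * (n : ℚ) - k) := by
  have hn' : (2 : ℚ) ≤ n := by exact_mod_cast hn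
  have d0 : pvar [(n : ℚ), x, k] 0 = (n : ℚ) := rfl
  have d1 : pvar [(n : ℚ), x, k] 1 = x := rfl
  have d2 : pvar [(n : ℚ), x, k] 2 = k := rfl
  have hrel := relM3b n hn x k
  have cT31 := coord_T31 n hn x k hx hk0 hk
  have cT41 := coord_T41 n hn x k hx hk0 hk
  have kd := peval_eq_of_kron (Expr.mul eG_T32 eD_T32) (Expr.mul eRM3b_T32 eLd_T32) (by decide +kernel)
    (by decide +kernel) (n : ℚ) x k
  have k0 := peval_eq_of_kron (Expr.mul eG_T32 eC0_T32)
    (Expr.add (Expr.neg (Expr.mul eRM3b_T31 (Expr.mul eLq_T32_T31 eC0_T31))) (Expr.neg (Expr.mul eRM3b_T41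
    (Expr.mul eLq_T32_T41 eC0_T41)))) (by decide +kernel) (by decide +kernel) (n : ℚ) x k
  have k1 := peval_eq_of_kron (Expr.mul eG_T32 eC1_T32)
    (Expr.add (Expr.neg (Expr.mul eRM3b_T31 (Expr.mul eLq_T32_T31 eC1_T31))) (Expr.neg (Expr.mul eRM3b_T41
    (Expr.mul eLq_T32_T41 eC1_T41)))) (by decide +kernel) (by decide +kernel) (n : ℚ) x k
  have klT31 := peval_eq_of_kron (Expr.mul eLq_T32_T31 eD_T31) eLd_T32 (by decide +kernel) (by decide +kernel) (n : ℚ) x k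
  have klT41 := peval_eq_of_kron (Expr.mul eLq_T32_T41 eD_T41) eLd_T32 (by decide +kernel) (by decide +kernel) (n : ℚ) x k
  simp only [peval_add, peval_neg, peval_mul] at kd k0 k1 klT31 klT41
  have hG : peval eG_T32 [(n : ℚ), x, k] ≠ 0 := by
    simp only [eG_T32, peval_add, peval_mul, peval_num, peval_var, d0, d1, d2]
    push_cast
    exact (mul_ne_zero (ne_of_lt (by linarith)) (mul_ne_zero (ne_of_lt (by linarith)) (mul_ne_zero (ne_of_lt (by linarith)) (ne_of_lt (by linarith)))))
  apply mul_left_cancel₀ hG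
  linear_combination T n ((3 * (n : ℚ) - x - k) + 3) ((2 * (n : ℚ) - k) + 2) * kd + peval eLd_T32 [(n : ℚ), x, k] * hrel - T n (3
    * (n : ℚ) - x - k) (2 * (n : ℚ) - k) * k0 - T n ((3 * (n : ℚ) - x - k) + 1) (2 * (n : ℚ) - k) * k1 +
    (-(peval eRM3b_T31 [(n : ℚ), x, k]) * peval eLq_T32_T31 [(n : ℚ), x, k]) * cT31 + ((peval eRM3b_T31 [(n
    : ℚ), x, k]) * T n ((3 * (n : ℚ) - x - k) + 3) ((2 * (n : ℚ) - k) + 1)) * klT31 + (-(peval eRM3b_T41 [(n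
    : ℚ), x, k]) * peval eLq_T32_T41 [(n : ℚ), x, k]) * cT41 + ((peval eRM3b_T41 [(n : ℚ), x, k]) * T n ((3
    * (n : ℚ) - x - k) + 4) ((2 * (n : ℚ) - k) + 1)) * klT41

/-- Cancelled factor `g` of the coordinate step for `T n ((3 * (n : ℚ) - x - k) + 4) ((2 * (n : ℚ) - k) + 2)`: `(x - 2)*(-w + x - 2)`. -/
def eG_T42 : Expr :=
  (Expr.mul (Expr.add (Expr.var 1) (Expr.num (-2))) (Expr.add (Expr.add (Expr.neg (Expr.var 0)) (Expr.var 1)) (Expr.num (-2))))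

/-- Common denominator of the step for `T n ((3 * (n : ℚ) - x - k) + 4) ((2 * (n : ℚ) - k) + 2)`: `(x - 2)*(x - 1)*(-k + w + 1)*(-k + w + 2)*(k - 2*w + x - 4)*(k - 2*w + x - 3)*(k - 2*w + x - 2)`. -/
def eLd_T42 : Expr :=
  (Expr.mul (Expr.add (Expr.var 1) (Expr.num (-1))) (Expr.mul (Expr.add (Expr.var 1) (Expr.num (-2))) (Expr.mul (Expr.add (Expr.add (Expr.var 0) (Expr.neg (Expr.var 2))) (Expr.num
  1)) (Expr.mul (Expr.add (Expr.add (Expr.var 0) (Expr.neg (Expr.var 2))) (Expr.num 2)) (Expr.mul (Expr.add (Expr.add (Expr.add (Expr.mul (Expr.num (-2)) (Expr.var 0)) (Expr.var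
  1)) (Expr.var 2)) (Expr.num (-4))) (Expr.mul (Expr.add (Expr.add (Expr.add (Expr.mul (Expr.num (-2)) (Expr.var 0)) (Expr.var 1)) (Expr.var 2)) (Expr.num (-3))) (Expr.add
  (Expr.add (Expr.add (Expr.mul (Expr.num (-2)) (Expr.var 0)) (Expr.var 1)) (Expr.var 2)) (Expr.num (-2)))))))))

/-- Cofactor `L/d` of `T n ((3 * (n : ℚ) - x - k) + 3) ((2 * (n : ℚ) - k) + 1)` in the step for `T n ((3 * (n : ℚ) - x - k) + 4) ((2 * (n : ℚ) - k) + 2)`: `-k**2*x + 2*k**2 + 3*k*w*x - 6*k*w - k*x**2 + 8*k*x - 12*k - 2*w**2*x + 4*w**2 + w*x**2 - 10*w*x + 16*w + 2*x**2 - 12*x + 16`. -/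
def eLq_T42_T31 : Expr :=
  (Expr.mul (Expr.add (Expr.var 1) (Expr.num (-2))) (Expr.mul (Expr.add (Expr.add (Expr.var 0) (Expr.neg (Expr.var 2))) (Expr.num 2)) (Expr.add (Expr.add (Expr.add (Expr.mul
  (Expr.num (-2)) (Expr.var 0)) (Expr.var 1)) (Expr.var 2)) (Expr.num (-4)))))

/-- Cofactor `L/d` of `T n ((3 * (n : ℚ) - x - k) + 4) ((2 * (n : ℚ) - k) + 1)` in the step for `T n ((3 * (n : ℚ) - x - k) + 4) ((2 * (n : ℚ) - k) + 2)`: `k - w - 2`. -/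
def eLq_T42_T41 : Expr :=
  (Expr.add (Expr.add (Expr.neg (Expr.var 0)) (Expr.var 2)) (Expr.num (-2)))

/-- Cofactor `L/d` of `T n ((3 * (n : ℚ) - x - k) + 3) ((2 * (n : ℚ) - k) + 2)` in the step for `T n ((3 * (n : ℚ) - x - k) + 4) ((2 * (n : ℚ) - k) + 2)`: `-k*x**2 + 3*k*x - 2*k + 2*w*x**2 - 6*w*x + 4*w - x**3 + 7*x**2 - 14*x + 8`. -/
def eLq_T42_T32 : Expr :=
  (Expr.mul (Expr.num (-1)) (Expr.mul (Expr.add (Expr.var 1) (Expr.num (-1))) (Expr.mul (Expr.add (Expr.var 1) (Expr.num (-2))) (Expr.add (Expr.add (Expr.add (Expr.mul (Expr.num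
  (-2)) (Expr.var 0)) (Expr.var 1)) (Expr.var 2)) (Expr.num (-4))))))

/-- **Coordinates of `T n ((3 * (n : ℚ) - x - k) + 4) ((2 * (n : ℚ) - k) + 2)`** (from M4(3,1)): `d·Y = c₀·T(n;p,q) + c₁·T(n;p+1,q)`. -/
theorem coord_T42 (n : ℕ) (hn : 2 ≤ n) (x k : ℚ) (hx : x < 0) (hk0 : 0 ≤ k) (hk : k + 1 ≤ (n : ℚ)) :
    peval eD_T42 [(n : ℚ), x, k] * T n ((3 * (n : ℚ) - x - k) + 4) ((2 * (n : ℚ) - k) + 2)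
      = peval eC0_T42 [(n : ℚ), x, k] * T n (3 * (n : ℚ) - x - k) (2 * (n : ℚ) - k) + peval eC1_T42 [(n : ℚ), x, k] * T n ((3 * (n : ℚ) - x - k) + 1) (2 * (n : ℚ) - k) := by
  have hn' : (2 : ℚ) ≤ n := by exact_mod_cast hn
  have d0 : pvar [(n : ℚ), x, k] 0 = (n : ℚ) := rfl
  have d1 : pvar [(n : ℚ), x, k] 1 = x := rfl
  have hrel := relM4b n hn x k
  have cT31 := coord_T31 n hn x k hx hk0 hk
  have cT41 := coord_T41 n hn x k hx hk0 hk
  have cT32 := coord_T32 n hn x k hx hk0 hk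
  have kd := peval_eq_of_kron (Expr.mul eG_T42 eD_T42) (Expr.mul eRM4b_T42 eLd_T42) (by decide +kernel)
    (by decide +kernel) (n : ℚ) x k
  have k0 := peval_eq_of_kron (Expr.mul eG_T42 eC0_T42)
    (Expr.add (Expr.add (Expr.neg (Expr.mul eRM4b_T31 (Expr.mul eLq_T42_T31 eC0_T31))) (Expr.neg (Expr.mul
    eRM4b_T41 (Expr.mul eLq_T42_T41 eC0_T41)))) (Expr.neg (Expr.mul eRM4b_T32 (Expr.mul eLq_T42_T32
    eC0_T32)))) (by decide +kernel) (by decide +kernel) (n : ℚ) x k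
  have k1 := peval_eq_of_kron (Expr.mul eG_T42 eC1_T42)
    (Expr.add (Expr.add (Expr.neg (Expr.mul eRM4b_T31 (Expr.mul eLq_T42_T31 eC1_T31))) (Expr.neg (Expr.mul
    eRM4b_T41 (Expr.mul eLq_T42_T41 eC1_T41)))) (Expr.neg (Expr.mul eRM4b_T32 (Expr.mul eLq_T42_T32
    eC1_T32)))) (by decide +kernel) (by decide +kernel) (n : ℚ) x k
  have klT31 := peval_eq_of_kron (Expr.mul eLq_T42_T31 eD_T31) eLd_T42 (by decide +kernel) (by decide +kernel) (n : ℚ) x k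
  have klT41 := peval_eq_of_kron (Expr.mul eLq_T42_T41 eD_T41) eLd_T42 (by decide +kernel) (by decide +kernel) (n : ℚ) x k
  have klT32 := peval_eq_of_kron (Expr.mul eLq_T42_T32 eD_T32) eLd_T42 (by decide +kernel) (by decide +kernel) (n : ℚ) x k
  simp only [peval_add, peval_neg, peval_mul] at kd k0 k1 klT31 klT41 klT32
  have hG : peval eG_T42 [(n : ℚ), x, k] ≠ 0 := by
    simp only [eG_T42, peval_add, peval_neg, peval_mul, peval_num, peval_var, d0, d1]
    push_cast
    exact (mul_ne_zero (ne_of_lt (by linarith)) (ne_of_lt (by linarith)))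
  apply mul_left_cancel₀ hG
  linear_combination T n ((3 * (n : ℚ) - x - k) + 4) ((2 * (n : ℚ) - k) + 2) * kd + peval eLd_T42 [(n : ℚ), x, k] * hrel - T n (3
    * (n : ℚ) - x - k) (2 * (n : ℚ) - k) * k0 - T n ((3 * (n : ℚ) - x - k) + 1) (2 * (n : ℚ) - k) * k1 +
    (-(peval eRM4b_T31 [(n : ℚ), x, k]) * peval eLq_T42_T31 [(n : ℚ), x, k]) * cT31 + ((peval eRM4b_T31 [(n
    : ℚ), x, k]) * T n ((3 * (n : ℚ) - x - k) + 3) ((2 * (n : ℚ) - k) + 1)) * klT31 + (-(peval eRM4b_T41 [(n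
    : ℚ), x, k]) * peval eLq_T42_T41 [(n : ℚ), x, k]) * cT41 + ((peval eRM4b_T41 [(n : ℚ), x, k]) * T n ((3
    * (n : ℚ) - x - k) + 4) ((2 * (n : ℚ) - k) + 1)) * klT41 + (-(peval eRM4b_T32 [(n : ℚ), x, k]) * peval
    eLq_T42_T32 [(n : ℚ), x, k]) * cT32 + ((peval eRM4b_T32 [(n : ℚ), x, k]) * T n ((3 * (n : ℚ) - x - k) +
    3) ((2 * (n : ℚ) - k) + 2)) * klT32

/-- Cancelled factor `g` of the coordinate step for `T (n + 1) ((3 * (n : ℚ) - x - k) + 3) ((2 * (n : ℚ) - k) + 2)`: `(x - 1)*(-k + w + 2)**2*(k - 2*w + x - 4)*(k - 2*w + x - 3)**2`. -/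
def eG_U : Expr :=
  (Expr.mul (Expr.add (Expr.add (Expr.var 0) (Expr.neg (Expr.var 2))) (Expr.num 2)) (Expr.mul (Expr.add (Expr.add (Expr.var 0) (Expr.neg (Expr.var 2))) (Expr.num 2)) (Expr.mul
  (Expr.add (Expr.add (Expr.add (Expr.mul (Expr.num (-2)) (Expr.var 0)) (Expr.var 1)) (Expr.var 2)) (Expr.num (-3))) (Expr.mul (Expr.add (Expr.add (Expr.add (Expr.mul (Expr.num
  (-2)) (Expr.var 0)) (Expr.var 1)) (Expr.var 2)) (Expr.num (-3))) (Expr.mul (Expr.add (Expr.var 1) (Expr.num (-1))) (Expr.add (Expr.add (Expr.add (Expr.mul (Expr.num (-2))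
  (Expr.var 0)) (Expr.var 1)) (Expr.var 2)) (Expr.num (-4))))))))

/-- Common denominator of the step for `T (n + 1) ((3 * (n : ℚ) - x - k) + 3) ((2 * (n : ℚ) - k) + 2)`: `(x - 1)*(-k + w + 1)*(-k + w + 2)*(k - 2*w + x - 4)*(k - 2*w + x - 3)*(k - 2*w + x - 2)`. -/
def eLd_U : Expr :=
  (Expr.mul (Expr.add (Expr.var 1) (Expr.num (-1))) (Expr.mul (Expr.add (Expr.add (Expr.var 0) (Expr.neg (Expr.var 2))) (Expr.num 1)) (Expr.mul (Expr.add (Expr.add (Expr.var 0)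
  (Expr.neg (Expr.var 2))) (Expr.num 2)) (Expr.mul (Expr.add (Expr.add (Expr.add (Expr.mul (Expr.num (-2)) (Expr.var 0)) (Expr.var 1)) (Expr.var 2)) (Expr.num (-4))) (Expr.mul
  (Expr.add (Expr.add (Expr.add (Expr.mul (Expr.num (-2)) (Expr.var 0)) (Expr.var 1)) (Expr.var 2)) (Expr.num (-3))) (Expr.add (Expr.add (Expr.add (Expr.mul (Expr.num (-2))
  (Expr.var 0)) (Expr.var 1)) (Expr.var 2)) (Expr.num (-2))))))))

/-- Cofactor `L/d` of `T n ((3 * (n : ℚ) - x - k) + 3) ((2 * (n : ℚ) - k) + 2)` in the step for `T (n + 1) ((3 * (n : ℚ) - x - k) + 3) ((2 * (n : ℚ) - k) + 2)`: `-k*x + k + 2*w*x - 2*w - x**2 + 5*x - 4`. -/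
def eLq_U_T32 : Expr :=
  (Expr.mul (Expr.num (-1)) (Expr.mul (Expr.add (Expr.var 1) (Expr.num (-1))) (Expr.add (Expr.add (Expr.add (Expr.mul (Expr.num (-2)) (Expr.var 0)) (Expr.var 1)) (Expr.var 2))
  (Expr.num (-4)))))

/-- Cofactor `L/d` of `T n ((3 * (n : ℚ) - x - k) + 4) ((2 * (n : ℚ) - k) + 2)` in the step for `T (n + 1) ((3 * (n : ℚ) - x - k) + 3) ((2 * (n : ℚ) - k) + 2)`: `-1`. -/
def eLq_U_T42 : Expr :=
  (Expr.num (-1))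

/-- **Coordinates of `T (n + 1) ((3 * (n : ℚ) - x - k) + 3) ((2 * (n : ℚ) - k) + 2)`** (from N1(3,2)): `d·Y = c₀·T(n;p,q) + c₁·T(n;p+1,q)`. -/
theorem coord_U (n : ℕ) (hn : 2 ≤ n) (x k : ℚ) (hx : x < 0) (hk0 : 0 ≤ k) (hk : k + 1 ≤ (n : ℚ)) :
    peval eD_U [(n : ℚ), x, k] * T (n + 1) ((3 * (n : ℚ) - x - k) + 3) ((2 * (n : ℚ) - k) + 2)
      = peval eC0_U [(n : ℚ), x, k] * T n (3 * (n : ℚ) - x - k) (2 * (n : ℚ) - k) + peval eC1_U [(n : ℚ), x, k] * T n ((3 * (n : ℚ) - x - k) + 1) (2 * (n : ℚ) - k) := by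
  have hn' : (2 : ℚ) ≤ n := by exact_mod_cast hn
  have d0 : pvar [(n : ℚ), x, k] 0 = (n : ℚ) := rfl
  have d1 : pvar [(n : ℚ), x, k] 1 = x := rfl
  have d2 : pvar [(n : ℚ), x, k] 2 = k := rfl
  have hrel := relN1a n hn x k
  have cT32 := coord_T32 n hn x k hx hk0 hk
  have cT42 := coord_T42 n hn x k hx hk0 hk
  have kd := peval_eq_of_kron (Expr.mul eG_U eD_U) (Expr.mul eRN1a_U eLd_U) (by decide +kernel)
    (by decide +kernel) (n : ℚ) x k
  have k0 := peval_eq_of_kron (Expr.mul eG_U eC0_U)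
    (Expr.add (Expr.neg (Expr.mul eRN1a_T32 (Expr.mul eLq_U_T32 eC0_T32))) (Expr.neg (Expr.mul eRN1a_T42 (Expr.mul
    eLq_U_T42 eC0_T42)))) (by decide +kernel) (by decide +kernel) (n : ℚ) x k
  have k1 := peval_eq_of_kron (Expr.mul eG_U eC1_U)
    (Expr.add (Expr.neg (Expr.mul eRN1a_T32 (Expr.mul eLq_U_T32 eC1_T32))) (Expr.neg (Expr.mul eRN1a_T42 (Expr.mul
    eLq_U_T42 eC1_T42)))) (by decide +kernel) (by decide +kernel) (n : ℚ) x k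
  have klT32 := peval_eq_of_kron (Expr.mul eLq_U_T32 eD_T32) eLd_U (by decide +kernel) (by decide +kernel) (n : ℚ) x k
  have klT42 := peval_eq_of_kron (Expr.mul eLq_U_T42 eD_T42) eLd_U (by decide +kernel) (by decide +kernel) (n : ℚ) x k
  simp only [peval_add, peval_neg, peval_mul] at kd k0 k1 klT32 klT42
  have hG : peval eG_U [(n : ℚ), x, k] ≠ 0 := by
    simp only [eG_U, peval_add, peval_neg, peval_mul, peval_num, peval_var, d0, d1, d2]
    push_cast
    exact (mul_ne_zero (ne_of_gt (by linarith)) (mul_ne_zero (ne_of_gt (by linarith)) (mul_ne_zero (ne_of_lt (by linarith)) (mul_ne_zero (ne_of_lt (by linarith)) (mul_ne_zero (ne_of_lt (by linarith)) (ne_of_lt (by linarith)))))))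
  apply mul_left_cancel₀ hG
  linear_combination T (n + 1) ((3 * (n : ℚ) - x - k) + 3) ((2 * (n : ℚ) - k) + 2) * kd + peval eLd_U [(n : ℚ), x, k] * hrel - T
    n (3 * (n : ℚ) - x - k) (2 * (n : ℚ) - k) * k0 - T n ((3 * (n : ℚ) - x - k) + 1) (2 * (n : ℚ) - k) * k1
    + (-(peval eRN1a_T32 [(n : ℚ), x, k]) * peval eLq_U_T32 [(n : ℚ), x, k]) * cT32 + ((peval eRN1a_T32 [(n
    : ℚ), x, k]) * T n ((3 * (n : ℚ) - x - k) + 3) ((2 * (n : ℚ) - k) + 2)) * klT32 + (-(peval eRN1a_T42 [(n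
    : ℚ), x, k]) * peval eLq_U_T42 [(n : ℚ), x, k]) * cT42 + ((peval eRN1a_T42 [(n : ℚ), x, k]) * T n ((3 *
    (n : ℚ) - x - k) + 4) ((2 * (n : ℚ) - k) + 2)) * klT42

/-- Cancelled factor `g` of the coordinate step for `T n ((3 * (n : ℚ) - x - k) - 1) (2 * (n : ℚ) - k)`: `1`. -/
def eG_Tm10 : Expr :=
  (Expr.num 1)

/-- Common denominator of the step for `T n ((3 * (n : ℚ) - x - k) - 1) (2 * (n : ℚ) - k)`: `1`. -/
def eLd_Tm10 : Expr :=
  (Expr.num 1)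

/-- **Coordinates of `T n ((3 * (n : ℚ) - x - k) - 1) (2 * (n : ℚ) - k)`** (from P2(-1,0)): `d·Y = c₀·T(n;p,q) + c₁·T(n;p+1,q)`. -/
theorem coord_Tm10 (n : ℕ) (hn : 2 ≤ n) (x k : ℚ) (_hx : x < 0) (_hk0 : 0 ≤ k) (_hk : k + 1 ≤ (n : ℚ)) :
    peval eD_Tm10 [(n : ℚ), x, k] * T n ((3 * (n : ℚ) - x - k) - 1) (2 * (n : ℚ) - k)
      = peval eC0_Tm10 [(n : ℚ), x, k] * T n (3 * (n : ℚ) - x - k) (2 * (n : ℚ) - k) + peval eC1_Tm10 [(n : ℚ), x, k] * T n ((3 * (n : ℚ) - x - k) + 1) (2 * (n : ℚ) - k) := by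
  have hrel := relP2m n hn x k
  have kd := peval_eq_of_kron (Expr.mul eG_Tm10 eD_Tm10) (Expr.mul eRP2m_Tm10 eLd_Tm10) (by decide +kernel)
    (by decide +kernel) (n : ℚ) x k
  have k0 := peval_eq_of_kron (Expr.mul eG_Tm10 eC0_Tm10)
    (Expr.neg (Expr.mul eRP2m_T00 eLd_Tm10)) (by decide +kernel) (by decide +kernel) (n : ℚ) x k
  have k1 := peval_eq_of_kron (Expr.mul eG_Tm10 eC1_Tm10)
    (Expr.neg (Expr.mul eRP2m_T10 eLd_Tm10)) (by decide +kernel) (by decide +kernel) (n : ℚ) x k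
  simp only [peval_neg, peval_mul] at kd k0 k1
  have hG : peval eG_Tm10 [(n : ℚ), x, k] ≠ 0 := by rw [eG_Tm10, peval_num]; norm_num
  apply mul_left_cancel₀ hG
  linear_combination T n ((3 * (n : ℚ) - x - k) - 1) (2 * (n : ℚ) - k) * kd + peval eLd_Tm10 [(n : ℚ), x, k] * hrel - T n (3 * (n
    : ℚ) - x - k) (2 * (n : ℚ) - k) * k0 - T n ((3 * (n : ℚ) - x - k) + 1) (2 * (n : ℚ) - k) * k1

/-- Coefficient of `T n ((3 * (n : ℚ) - x - k) - 1) ((2 * (n : ℚ) - k) - 1)` in the combined instance Cmm = (coef of T(p,q−1) in M4)·M3 − (coef in M3)·M4: `-x*(-k + w)*(-w + x)`. -/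
def eRCmm_Tm1m1 : Expr :=
  (Expr.mul (Expr.num (-1)) (Expr.mul (Expr.var 1) (Expr.mul (Expr.add (Expr.var 0) (Expr.neg (Expr.var 2)))
  (Expr.add (Expr.neg (Expr.var 0)) (Expr.var 1)))))

/-- Coefficient of `T n ((3 * (n : ℚ) - x - k) - 1) (2 * (n : ℚ) - k)` in the combined instance Cmm = (coef of T(p,q−1) in M4)·M3 − (coef in M3)·M4: `x*(-2*w + x)*(-w + x)`. -/
def eRCmm_Tm10 : Expr :=
  (Expr.mul (Expr.var 1) (Expr.mul (Expr.add (Expr.neg (Expr.var 0)) (Expr.var 1)) (Expr.add (Expr.mul (Expr.num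
  (-2)) (Expr.var 0)) (Expr.var 1))))

/-- Coefficient of `T n (3 * (n : ℚ) - x - k) (2 * (n : ℚ) - k)` in the combined instance Cmm = (coef of T(p,q−1) in M4)·M3 − (coef in M3)·M4: `-x*(-w + x)*(k - 2*w + x)`. -/
def eRCmm_T00 : Expr :=
  (Expr.mul (Expr.num (-1)) (Expr.mul (Expr.var 1) (Expr.mul (Expr.add (Expr.neg (Expr.var 0)) (Expr.var 1))
  (Expr.add (Expr.add (Expr.mul (Expr.num (-2)) (Expr.var 0)) (Expr.var 1)) (Expr.var 2)))))

/-- Combined instance Cmm (eliminating `T(n;p,q−1)` between M3(−1,−1) and M4(−1,−1)). -/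
theorem relCmm (n : ℕ) (hn : 2 ≤ n) (x k : ℚ) :
    peval eRCmm_Tm1m1 [(n : ℚ), x, k] * T n ((3 * (n : ℚ) - x - k) - 1) ((2 * (n : ℚ) - k) - 1) + peval eRCmm_Tm10 [(n : ℚ), x, k] * T n ((3 * (n : ℚ) - x - k) - 1) (2 * (n : ℚ) - k)
      + peval eRCmm_T00 [(n : ℚ), x, k] * T n (3 * (n : ℚ) - x - k) (2 * (n : ℚ) - k) = 0 := by
  have r3 := relM3m n hn x k
  have r4 := relM4m n hn x k
  have f1 := peval_eq_of_kron eRCmm_Tm1m1 (Expr.sub (Expr.mul eRM4m_T0m1 eRM3m_Tm1m1) (Expr.mul eRM3m_T0m1 eRM4m_Tm1m1))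
    (by decide +kernel) (by decide +kernel) (n : ℚ) x k
  have f2 := peval_eq_of_kron eRCmm_Tm10 (Expr.sub (Expr.mul eRM4m_T0m1 eRM3m_Tm10) (Expr.mul eRM3m_T0m1 eRM4m_Tm10))
    (by decide +kernel) (by decide +kernel) (n : ℚ) x k
  have f3 := peval_eq_of_kron eRCmm_T00 (Expr.neg (Expr.mul eRM3m_T0m1 eRM4m_T00))
    (by decide +kernel) (by decide +kernel) (n : ℚ) x k
  simp only [peval_sub, peval_mul, peval_neg] at f1 f2 f3
  linear_combination peval eRM4m_T0m1 [(n : ℚ), x, k] * r3 - peval eRM3m_T0m1 [(n : ℚ), x, k] * r4 + T n ((3 * (n : ℚ) - x - k) - 1) ((2 * (n : ℚ) - k) - 1) * f1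
    + T n ((3 * (n : ℚ) - x - k) - 1) (2 * (n : ℚ) - k) * f2 + T n (3 * (n : ℚ) - x - k) (2 * (n : ℚ) - k) * f3

/-- Cancelled factor `g` of the coordinate step for `T n ((3 * (n : ℚ) - x - k) - 1) ((2 * (n : ℚ) - k) - 1)`: `x*(-2*w + x)*(-w + x)`. -/
def eG_Tm1m1 : Expr :=
  (Expr.mul (Expr.var 1) (Expr.mul (Expr.add (Expr.neg (Expr.var 0)) (Expr.var 1)) (Expr.add (Expr.mul (Expr.num (-2)) (Expr.var 0)) (Expr.var 1))))

/-- Common denominator of the step for `T n ((3 * (n : ℚ) - x - k) - 1) ((2 * (n : ℚ) - k) - 1)`: `(-2*w + x)*(k - 2*w + x)`. -/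
def eLd_Tm1m1 : Expr :=
  (Expr.mul (Expr.add (Expr.mul (Expr.num (-2)) (Expr.var 0)) (Expr.var 1)) (Expr.add (Expr.add (Expr.mul (Expr.num (-2)) (Expr.var 0)) (Expr.var 1)) (Expr.var 2)))

/-- Cofactor `L/d` of `T n ((3 * (n : ℚ) - x - k) - 1) (2 * (n : ℚ) - k)` in the step for `T n ((3 * (n : ℚ) - x - k) - 1) ((2 * (n : ℚ) - k) - 1)`: `1`. -/
def eLq_Tm1m1_Tm10 : Expr :=
  (Expr.num 1)

end VIMInner.NK

end Summit.KontsevichZagierPeriods.Zeta5Search.Certificates
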